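import Literature.NumberTheory.QuadraticForms.HermitianCongruenceOfLocalNorms
import Literature.NumberTheory.Rogawski1990.AdelicCartanClass
import HarnessLib

/-!
# The signature step (P3) of Kottwitz's criterion for `U(H)`: the `hsig` binder of ★ `cartanObsHasse_of_steps`, discharged
# (Rogawski 1990, §3.3 Prop. 3.3.1 p. 22 — the local conditions at `∞`; §3.5 Prop. 3.5.2 p. 29; Landherr 1936)

Topic `NumberTheory/Rogawski1990`; namespace `Literature.NumberTheory.Rogawski1990`; **THEOREMS ONLY** (no definition, no named fact, no instance, no
notation, no `sorry`).  Cell `pub/hodgecm-mathlib`, ENGINE T1 (crux H413 = `stmt-HodgeConjecture-24833`), row G6, piece **P3 «SIGNATURES»** of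
`BLUEPRINT-R6dR7-CartanObsHasse` (0a35b92f), in the letters of ★ `Rogawski1990.cartanObsHasse_of_steps` (P5, p816074): its hypothesis `hsig` VERBATIM, proved —
the mathematics is ★ `QuadraticForms.forall_card_pos_eigenvalues_map_eq_mul_of_inv_mul_twistGram_eq` (the identity `H_𝔸⁻¹ · ᵗ(σ_𝔸 g) H_𝔸 g = t⋆ · (y ⊗ 1) · t`
IS the adelic congruence `H_{g t⁻¹} = (H · y)_𝔸`; its archimedean component is a congruence over `L ⊗ ℝ`, read at each complex embedding by ★ (G-c∞)
`exists_gl_congr_map_of_twistGram_arch_cm` and turned into equal positive indices by Sylvester ★ (G-c)); of the binder's hypotheses only the last is used.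
Companion of ★ `Rogawski1990.cartanObsHasse_hdisc` (P2, B-p12).  HC_CM is proved only modulo the printed citations until rung 0 closes.

* `cartanObsHasse_hsig (hHd : H.det ≠ 0)` : the `hsig` binder of ★ `cartanObsHasse_of_steps` :98–:105, so that the trunk's R7 reads
  `cartanObsHasse_of_steps hH hHd hreg obs P4 (cartanObsHasse_hdisc hHd) (cartanObsHasse_hsig hHd) P1`.

## References
* [Rogawski1990] J. D. Rogawski, *Automorphic Representations of Unitary Groups in Three Variables*, Ann. of Math. Stud. 123 (1990), §3.3 Prop. 3.3.1
  p. 22, §3.5 Prop. 3.5.2 p. 29.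
* [Landherr1936HermitianForms] W. Landherr, Abh. Math. Sem. Hamburg 11 (1936) 245–248.
* [Kottwitz1986] R. E. Kottwitz, *Stable trace formula: elliptic singular terms*, Math. Ann. 275 (1986), §9.
-/

set_option autoImplicit false

noncomputable section

open NumberField IsDedekindDomain
open scoped Matrix MatrixGroups

namespace Literature.NumberTheory.Rogawski1990

open Literature.NumberTheory.Automorphic
open Literature.AlgebraicGeometry.ShimuraVarieties (unitaryGroup)

section Self

variable {L : Type} [Field L] [NumberField L] [IsCMField L] {H : Matrix (Fin 3) (Fin 3) L} {γ₀ : (UnitaryGroup.cmDatum L 3 H).Rational}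

/-- **P3 «SIGNATURES» — the `hsig` binder of ★ `cartanObsHasse_of_steps`, discharged**: for every matching adèle `p` over `γ₀`, adelic conjugator `g`,
global `⋆`-symmetric unit `y ∈ Z(γ₀)` and `t ∈ GL₃(𝔸_L)` with `H_𝔸⁻¹ · ᵗ(σ_𝔸 g) H_𝔸 g = t⋆ · (y ⊗ 1) · t`, the hermitian matrices `ρ(H)` and `ρ(H · y)` have the
same number of positive eigenvalues at every complex embedding `ρ` of `L` (★ `QuadraticForms.forall_card_pos_eigenvalues_map_eq_mul_of_inv_mul_twistGram_eq`;
only `det H ≠ 0` and the last hypothesis are used). [cite: Rogawski1990, §3.3 Prop. 3.3.1 p. 22 (local conditions at `∞`); §3.5 Prop. 3.5.2 p. 29]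
[cite: Landherr1936HermitianForms] [cite: Kottwitz1986, §9] -/
theorem cartanObsHasse_hsig (hHd : H.det ≠ 0) :
    ∀ (p : MatchingAdeleG₂ L H H γ₀) (g : GL (Fin 3) (AdeleRing (𝓞 L) L)) (y : Matrix (Fin 3) (Fin 3) L) (t : GL (Fin 3) (AdeleRing (𝓞 L) L)),
      g * (((UnitaryGroup.cmDatum L 3 H).toAdelic γ₀).val : GL (Fin 3) (AdeleRing (𝓞 L) L)) * g⁻¹ = (p.adele.val : GL (Fin 3) (AdeleRing (𝓞 L) L)) →
      Commute y (((γ₀ : unitaryGroup (cmConjRingHom L) H).val : GL (Fin 3) L) : Matrix (Fin 3) (Fin 3) L) → hermStar (cmConjRingHom L) H y = y → IsUnit y.det →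
      (H.map (algebraMap L (AdeleRing (𝓞 L) L)))⁻¹ * twistGram (adeleConj L) (H.map (algebraMap L (AdeleRing (𝓞 L) L))) (g : Matrix (Fin 3) (Fin 3) (AdeleRing (𝓞 L) L)) =
        hermStar (adeleConj L) (H.map (algebraMap L (AdeleRing (𝓞 L) L))) (t : Matrix (Fin 3) (Fin 3) (AdeleRing (𝓞 L) L)) *
          y.map (algebraMap L (AdeleRing (𝓞 L) L)) * (t : Matrix (Fin 3) (Fin 3) (AdeleRing (𝓞 L) L)) →
      ∀ (ρ : L →+* ℂ) (h₁ : (H.map ρ).IsHermitian) (h₂ : ((H * y).map ρ).IsHermitian),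
        (Finset.univ.filter fun i => 0 < h₁.eigenvalues i).card = (Finset.univ.filter fun i => 0 < h₂.eigenvalues i).card :=
  fun _ g _ t _ _ _ _ hx => QuadraticForms.forall_card_pos_eigenvalues_map_eq_mul_of_inv_mul_twistGram_eq L 3 hHd g t hx

end Self

end Literature.NumberTheory.Rogawski1990

end
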